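import Mathlib
import Summits.KontsevichZagierPeriods.Zeta5Search.LemmaDBonusTypes
import Summits.KontsevichZagierPeriods.Zeta5Search.CellKitCentre
import Summits.KontsevichZagierPeriods.Zeta5Search.RecShapesM52Proof
import Summits.KontsevichZagierPeriods.Zeta5Search.ClusterValuationKBounds
import HarnessLib

/-!
# ζ(5) search — CLASS TYPE COVERS I: the class data of a residue class from its LEVEL TYPE (p3 g6)

HONEST FRAMING: systematic search; no irrationality claim unless certified.  Cell `pub-zeta5`, prover seat p3, generation 6.

The by-name class laws of the tree (THEOREM LB `casoratianClassBound_holds`, the Lemma-D bonus `lemmaDBonus_holds`, the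
double-drop bonus `doubleDropBonus_holds`, …) read a residue class `x (mod p)` of a parameter vector `b` only through its CLASS
DATA: `classExp`, `classPoleCount`, `tameSingle`, `classNu`, `expVector`, `CentreIn`, `droppedPair`, `sameType`.  On a ray
`b = n·β` and a `θ`-window these data are functions of the LEVEL TYPE of the class — the list `T = [netExp b (x + kp)]_{k ≤ L}`
of net exponents along the class `x < x + p < … < x + Lp ≤ b₀` — and of the centre flag `CentreIn b p x`.  This file (any `b`):

* §1 computable class data of a list: `polesL`, `tameL`, `expL`, `nuL`, `droppedL`, `sameTypeL`;
* §2 the predicate `IsType b p x T cen` (the class of `x` is the level class of type `T` with centre flag `cen`), its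
  constructors from level facts (`Levels`, `levels_cons`, `isType_of_ne` / `isType_of_eq`), and
* §3 the TRANSFER theorems `IsType.expVector_eq / classExp_eq / classPoleCount_eq / tameSingle_eq / classNu_eq /
  droppedPair_eq / sameType_eq / pal_classSet`.

File II (`ClassTypeGuards`) turns a COVER of all residues by finitely many types into the hypotheses of the class laws by a
decidable check.  Integer bookkeeping of net exponents; valuations of rationals; nothing here bears on irrationality.
-/

open Finset

namespace Summit.KontsevichZagierPeriods.Zeta5Search.ClassTypeCover

open Summit.KontsevichZagierPeriods.Zeta5Search.ClusterValuation
open Summit.KontsevichZagierPeriods.Zeta5Search.LevelClass (classSet_level level_injective)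
open Summit.KontsevichZagierPeriods.Zeta5Search.CellKit (classExp_eq_levelSum centreIn_iff_last)
open Summit.KontsevichZagierPeriods.Zeta5Search.SecondOrder (classTypeList classTypeList_level)

/-! ## §1 Class data of an exponent list -/

/-- Number of poles (negative entries). -/
def polesL (T : List ℤ) : ℕ := (T.filter fun v => decide (v < 0)).length

/-- Tameness: the first non-positive entry is negative (the lowest pole has only zeros of `R_b` below it). -/
def tameL : List ℤ → Bool
  | [] => false
  | e :: T => if e < 0 then true else if 0 < e then tameL T else false

/-- Class exponent: the sum, plus `1` for a self-conjugate class when `b₀` is odd. -/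
def expL (odd : Bool) (T : List ℤ) (cen : Bool) : ℤ := T.sum + if (odd && cen) = true then 1 else 0

/-- `ν` of a class: `max(E, 0)` for a tame single-pole class, else `E`. -/
def nuL (odd : Bool) (T : List ℤ) (cen : Bool) : ℤ :=
  if polesL T = 1 ∧ tameL T = true then max (expL odd T cen) 0 else expL odd T cen

/-- Dropped (even palindromic non-self-conjugate) class. -/
def droppedL (odd : Bool) (T : List ℤ) (cen : Bool) : Bool :=
  !cen && decide (T = T.reverse) && decide (Even (expL odd T cen))

/-- Same type: equal centre flags and equal-or-reversed exponent lists. -/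
def sameTypeL (T : List ℤ) (cen : Bool) (T' : List ℤ) (cen' : Bool) : Bool :=
  decide (cen = cen') && (decide (T = T') || decide (T = T'.reverse))

/-- `tameL` unfolded: some entry is negative and every earlier entry is positive. -/
theorem tameL_eq_true_iff (T : List ℤ) :
    tameL T = true ↔ ∃ k, k < T.length ∧ T.getD k 0 < 0 ∧ ∀ j, j < k → 0 < T.getD j 0 := by
  induction T with
  | nil => simp [tameL]
  | cons e T ih =>
      simp only [tameL, List.length_cons]
      by_cases he : e < 0
      · simp only [he, ↓reduceIte, true_iff]
        exact ⟨0, by omega, by simpa using he, fun j hj => absurd hj (Nat.not_lt_zero j)⟩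
      · simp only [he, ↓reduceIte]
        by_cases he' : 0 < e
        · simp only [he', ↓reduceIte, ih]
          constructor
          · rintro ⟨k, hk, hneg, hpos⟩
            refine ⟨k + 1, by omega, by simpa using hneg, fun j hj => ?_⟩
            cases j with
            | zero => simpa using he'
            | succ j => simpa using hpos j (by omega)
          · rintro ⟨k, hk, hneg, hpos⟩
            cases k with
            | zero => simp at hneg; omega
            | succ k =>
                refine ⟨k, by omega, by simpa using hneg, fun j hj => ?_⟩
                simpa using hpos (j + 1) (by omega)
        · simp only [he', ↓reduceIte, Bool.false_eq_true, false_iff, not_exists, not_and]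
          intro k hk hneg hpos
          cases k with
          | zero => simp at hneg; omega
          | succ k => have := hpos 0 (by omega); simp at this; omega

/-! ## §2 Level types -/

/-- Level facts along the progression `q, q + p, q + 2p, …`: `netExp b (q + kp) = T_k`. -/
def Levels (b : ℕ → ℤ) (q p : ℕ) (T : List ℤ) : Prop := ∀ k, k < T.length → netExp b (q + k * p) = T.getD k 0

/-- No levels. -/
theorem levels_nil (b : ℕ → ℤ) (q p : ℕ) : Levels b q p [] := fun k hk => absurd hk (Nat.not_lt_zero k)

/-- One more level at the bottom. -/
theorem levels_cons {b : ℕ → ℤ} {q p : ℕ} {e : ℤ} {T : List ℤ} (h0 : netExp b q = e) (h : Levels b (q + p) p T) :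
    Levels b q p (e :: T) := by
  intro k hk
  cases k with
  | zero => simpa using h0
  | succ k =>
      have hk' : k < T.length := by simpa using hk
      have e1 : q + (k + 1) * p = q + p + k * p := by ring
      rw [e1, h k hk']
      simp

/-- **The class of `x` modulo `p` is the level class `x < x + p < … < x + Lp ≤ b₀ < x + (L+1)p` (`L + 1 = |T|`) with net
exponents `T` and centre flag `cen` (`CentreIn b p x ↔ cen`).** -/
structure IsType (b : ℕ → ℤ) (p x : ℕ) (T : List ℤ) (cen : Bool) : Prop where
  pos : 0 < T.length
  lt : x < p
  top : x + (T.length - 1) * p ≤ (b 0).toNat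
  top' : (b 0).toNat < x + (T.length - 1) * p + p
  lev : Levels b x p T
  cen_iff : CentreIn b p x ↔ cen = true

variable {p : ℕ} [hp : Fact p.Prime]

/-- Constructor: a non-self-conjugate level class (`2x + Lp ≠ b₀`). -/
theorem isType_of_ne {b : ℕ → ℤ} (h0 : 0 ≤ b 0) {x : ℕ} (L : ℕ) {T : List ℤ} (hlen : T.length = L + 1) (hx : x < p)
    (hL : x + L * p ≤ (b 0).toNat) (hL' : (b 0).toNat < x + L * p + p) (hlev : Levels b x p T)
    (hne : 2 * x + L * p ≠ (b 0).toNat) : IsType b p x T false :=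
  ⟨by omega, hx, by rw [hlen]; simpa using hL, by rw [hlen]; simpa using hL', hlev,
    by rw [centreIn_iff_last b hx hL hL' h0]; simp [hne]⟩

/-- Constructor: the self-conjugate level class (`2x + Lp = b₀`). -/
theorem isType_of_eq {b : ℕ → ℤ} (h0 : 0 ≤ b 0) {x : ℕ} (L : ℕ) {T : List ℤ} (hlen : T.length = L + 1) (hx : x < p)
    (hL : x + L * p ≤ (b 0).toNat) (hL' : (b 0).toNat < x + L * p + p) (hlev : Levels b x p T)
    (heq : 2 * x + L * p = (b 0).toNat) : IsType b p x T true :=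
  ⟨by omega, hx, by rw [hlen]; simpa using hL, by rw [hlen]; simpa using hL', hlev,
    by rw [centreIn_iff_last b hx hL hL' h0]; simp [heq]⟩

/-! ## §3 Transfer: the class data of a typed class -/

section Transfer

variable {b : ℕ → ℤ} {x : ℕ} {T : List ℤ} {cen : Bool} (h : IsType b p x T cen)
include h

omit hp in
/-- The top level bounds with `L = |T| − 1`. -/
theorem IsType.bounds : x + (T.length - 1) * p ≤ (b 0).toNat ∧ (b 0).toNat < x + (T.length - 1) * p + p :=
  ⟨h.top, h.top'⟩

/-- **`expVector = T`.** -/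
theorem IsType.expVector_eq : expVector b p x = T := by
  have hE := expVector_level b h.lt h.top h.top'
  rw [hE]
  apply List.ext_getElem
  · simp; have := h.pos; omega
  · intro k hk hk'
    have hk2 : k < T.length := by simpa using hk'
    rw [List.getElem_map, List.getElem_range, h.lev k hk2, List.getD_eq_getElem?_getD, List.getElem?_eq_getElem hk2]
    rfl

/-- `classTypeList = T`. -/
theorem IsType.classTypeList_eq : classTypeList b p x = T := by
  rw [← h.expVector_eq, classTypeList_level (p := p) b h.top h.top', expVector_level b h.lt h.top h.top']

omit hp h in
/-- A range sum as a list sum. -/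
theorem sum_range_getD (T : List ℤ) : ∑ k ∈ range T.length, T.getD k 0 = T.sum := by
  induction T with
  | nil => simp
  | cons e T ih =>
      rw [List.length_cons, sum_range_succ', List.sum_cons]
      simp only [List.getD_cons_succ, List.getD_cons_zero]
      rw [ih, add_comm]

/-- **`classExp = expL`.** -/
theorem IsType.classExp_eq : classExp b p x = expL (decide (¬ (2 : ℤ) ∣ b 0)) T cen := by
  rw [classExp_eq_levelSum b h.lt h.top h.top', expL]
  have hlen : T.length - 1 + 1 = T.length := by have := h.pos; omega
  congr 1
  · rw [hlen, ← sum_range_getD]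
    exact sum_congr rfl fun k hk => h.lev k (mem_range.1 hk)
  · have hc := h.cen_iff
    by_cases h2 : (2 : ℤ) ∣ b 0 <;> cases cen <;> simp_all

/-- **`classPoleCount = polesL`.** -/
theorem IsType.classPoleCount_eq : classPoleCount b p x = polesL T := by
  rw [LongClass.classPoleCount_eq_length b h.lt h.top h.top', h.classTypeList_eq, polesL]

/-- **`tameSingle = tameL`.** -/
theorem IsType.tameSingle_eq : tameSingle b p x = tameL T := by
  have hp0 : 0 < p := hp.out.pos
  have hcs := classSet_level b h.lt h.top h.top'
  have hlen : T.length - 1 + 1 = T.length := by have := h.pos; omega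
  rw [hlen] at hcs
  rw [Bool.eq_iff_iff, tameSingle_iff, tameL_eq_true_iff]
  constructor
  · rintro ⟨q, hq, hneg, hor⟩
    rw [hcs, mem_image] at hq
    obtain ⟨k, hk, rfl⟩ := hq
    have hk' := mem_range.1 hk
    refine ⟨k, hk', by rw [← h.lev k hk']; exact hneg, fun j hj => ?_⟩
    rw [← h.lev j (by omega)]
    rcases hor with hlt | hall
    · exfalso
      have : p ≤ x + k * p := by
        have h1 : 1 ≤ k := by omega
        calc p = 1 * p := (one_mul p).symm
          _ ≤ k * p := Nat.mul_le_mul_right p h1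
          _ ≤ x + k * p := Nat.le_add_left _ _
      omega
    · exact hall (x + j * p) (by rw [hcs]; exact mem_image.2 ⟨j, mem_range.2 (by omega), rfl⟩)
        (by have := Nat.mul_lt_mul_of_pos_right hj hp0; omega)
  · rintro ⟨k, hk, hneg, hpos⟩
    refine ⟨x + k * p, by rw [hcs]; exact mem_image.2 ⟨k, mem_range.2 hk, rfl⟩, by rw [h.lev k hk]; exact hneg, ?_⟩
    rcases Nat.eq_zero_or_pos k with hk0 | hk0
    · left; subst hk0; simpa using h.lt
    · right
      intro s hs hlt
      rw [hcs, mem_image] at hs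
      obtain ⟨j, hj, rfl⟩ := hs
      have hjk : j < k := by
        by_contra hjk
        push Not at hjk
        have := Nat.mul_le_mul_right p hjk
        omega
      rw [h.lev j (by omega)]
      exact hpos j hjk

/-- **`classNu = nuL`.** -/
theorem IsType.classNu_eq : classNu b p x = nuL (decide (¬ (2 : ℤ) ∣ b 0)) T cen := by
  unfold classNu nuL
  rw [h.classPoleCount_eq, h.tameSingle_eq, h.classExp_eq]

/-- **`droppedPair = droppedL`.** -/
theorem IsType.droppedPair_eq : droppedPair b p x = droppedL (decide (¬ (2 : ℤ) ∣ b 0)) T cen := by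
  have hc := h.cen_iff
  unfold droppedPair droppedL
  rw [h.expVector_eq, h.classExp_eq]
  cases cen <;> simp_all

omit h in
/-- **`sameType = sameTypeL`** for two typed classes. -/
theorem IsType.sameType_eq {y : ℕ} {T' : List ℤ} {cen' : Bool} (h : IsType b p x T cen) (h' : IsType b p y T' cen') :
    sameType b p x y = sameTypeL T cen T' cen' := by
  have hc := h.cen_iff
  have hc' := h'.cen_iff
  unfold sameType sameTypeL
  rw [h.expVector_eq, h'.expVector_eq]
  cases cen <;> cases cen' <;> simp_all

/-- **A palindromic type gives the reflected-point palindrome of the class** (the hypothesis shape of `DoubleDropBonus`). -/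
theorem IsType.pal_classSet (hpal : T.reverse = T) :
    ∀ s ∈ classSet b p x, netExp b s = netExp b ((b 0).toNat - ((b 0).toNat - x) % p - (s - x)) := by
  have hL := h.top
  have hL' := h.top'
  set L := T.length - 1 with hLdef
  have hlen : L + 1 = T.length := by have := h.pos; omega
  intro s hs
  rw [classSet_level b h.lt hL hL', mem_image] at hs
  obtain ⟨k, hk, rfl⟩ := hs
  have hkL : k ≤ L := by have := mem_range.1 hk; omega
  have hmod : ((b 0).toNat - x) % p = (b 0).toNat - x - L * p := by
    have h1 := Nat.div_add_mod ((b 0).toNat - x) p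
    have hlo : L * p ≤ (b 0).toNat - x := by omega
    have hhi : (b 0).toNat - x < (L + 1) * p := by
      have : (L + 1) * p = L * p + p := by ring
      omega
    have h2 : ((b 0).toNat - x) / p = L := Nat.div_eq_of_lt_le hlo hhi
    rw [h2] at h1
    have : p * L = L * p := mul_comm _ _
    omega
  have e1 : (b 0).toNat - ((b 0).toNat - x) % p - (x + k * p - x) = x + (L - k) * p := by
    rw [hmod]
    have h3 : (L - k) * p + k * p = L * p := by rw [← Nat.add_mul, Nat.sub_add_cancel hkL]
    omega
  rw [e1, h.lev k (by omega), h.lev (L - k) (by omega)]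
  -- T_k = T_{L-k} for a palindrome
  have hk2 : L - k < T.length := by omega
  rw [List.getD_eq_getElem?_getD, List.getD_eq_getElem?_getD]
  conv_rhs => rw [← hpal, List.getElem?_reverse (by simpa using hk2)]
  congr 2
  omega

end Transfer

end Summit.KontsevichZagierPeriods.Zeta5Search.ClassTypeCover
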